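import Summits.HubbardSuperconductivity.HubbardSuperconductivity.Theses.AposterioriCapRg

/-!
# X1 probe — the repaired statements R′, [2]′, [3]′ elaborate and re-glue by pure logic (evidence, not a proposal)

Line lead attempt 1, crux stmt-HubbardSuperconductivity-13884, 2026-08-16.

Repair (a) of the verdict: every OPERATOR-side clause of the certified chain is read at the chemical potential the
Grassmann objects actually describe, `μ + U/2` (plain quartic `hubbardInteraction` + symmetric Matsubara truncation ⇒
midpoint tadpole ⇒ `U(n↑-½)(n↓-½)` ⇒ operator `μ + U/2`; Cruxes/…/DrefuteTadpole.lean), while every GRASSMANN-side clause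
(`symmetricRegimeCertificateT U μ …`, `hubbardScaleReportCT U μ D h`) keeps its `μ`.  Below: the three repaired
declarations (verbatim copies of the route decls with that single substitution) and the kernel-checked glue
`CapRgSymmetricCertificatePinned' → SeededBrokenRegimeBoseFermiPinned' → AposterioriOrderCriterionR' → FixedPointDWaveOrder`
(the witness of the target is `(U, δ, μ + U/2)`), i.e. repair (a) costs the route nothing but the re-typing.
Repair (b) (Literature: `hubbardInteraction v2 := V + (U/2)(βL²)⁻¹Σ_{kσ}ψ̂⁺_{kσ}ψ̂⁻_{kσ}`) keeps all four texts as they are.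
Also typed: the corrected transfer stub every line needs (`MatsubaraBridgeShifted`, drefute's signature with `3 ≤ L`).
-/

namespace X1Probe

open Literature.MathematicalPhysics.QuantumLattice Filter
open Summit.HubbardSuperconductivity.HubbardSuperconductivity.Theses.AposterioriCapRg

/-- R′ — `AposterioriOrderCriterionR` with the conclusion read at operator chemical potential `μ + U/2`. -/
def AposterioriOrderCriterionR' : Prop :=
  ∃ kStar etaStar : ℚ, 0 < kStar ∧ 0 < etaStar ∧ ∀ (U μ h₀ : ℝ) (D : HubbardScaleData), 0 < h₀ →
    (∀ h ∈ Set.Ioc (0:ℝ) h₀, ∃ L₀ : ℕ, D.IsCertifiedEnclosure (hubbardScaleReportCT U μ D h) L₀) →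
    D.MeetsThresholds kStar etaStar →
    ((D.meanFieldDensity.fst : ℚ) : ℝ) / 2 ≤ dWaveOrderParameter U (μ + U / 2)

/-- [2]′ — `CapRgSymmetricCertificatePinned` with the operator density clause read at `μ + U/2`. -/
def CapRgSymmetricCertificatePinned' : Prop :=
  ∃ U ∈ Set.Icc (2:ℝ) 3, ∃ δ ∈ Set.Icc (1/5:ℝ) (7/20), ∃ μ : ℝ,
    Tendsto (fun L : ℕ => ((hubbardTorusWith 2 (L + 1) 1 U (μ + U / 2)).groundStateFunctional totalNumber).re /
      ((L + 1 : ℕ) : ℝ) ^ 2) atTop (nhds (1 - δ)) ∧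
    ∀ Θ : SymmetricTolerance, ∃ (K : TrigPolyC4v) (Λ : ℝ) (L₀ : ℕ), symmetricRegimeCertificateT U μ capRgCornerDataT Θ K Λ L₀

/-- [3]′ — `SeededBrokenRegimeBoseFermiPinned` with its operator density hypothesis read at `μ + U/2`. -/
def SeededBrokenRegimeBoseFermiPinned' : Prop :=
  ∀ kStar etaStar : ℚ, 0 < kStar → 0 < etaStar → ∃ Θ : SymmetricTolerance, ∀ U ∈ Set.Icc (2:ℝ) 3,
    ∀ δ ∈ Set.Icc (1/5:ℝ) (7/20), ∀ μ : ℝ,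
    Tendsto (fun L : ℕ => ((hubbardTorusWith 2 (L + 1) 1 U (μ + U / 2)).groundStateFunctional totalNumber).re /
      ((L + 1 : ℕ) : ℝ) ^ 2) atTop (nhds (1 - δ)) →
    ∀ (K : TrigPolyC4v) (Λ : ℝ) (L₀ : ℕ), symmetricRegimeCertificateT U μ capRgCornerDataT Θ K Λ L₀ →
    ∃ h₀ : ℝ, 0 < h₀ ∧ ∃ D : HubbardScaleData, D.MeetsThresholds kStar etaStar ∧ 0 < D.numPatches ∧
      0 < D.meanFieldDensity.fst ∧
      ∀ h ∈ Set.Ioc (0:ℝ) h₀, ∃ L₀' : ℕ, D.IsCertifiedEnclosure (hubbardScaleReportCT U μ D h) L₀'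

/-- The corrected transfer stub (drefute, NegativeNotesStubMatsubaraBridge.md): gapped frame, `3 ≤ L`, operator side at
`μ + U/2`. Every line needs it; under repair (b) the `+ U/2` disappears. -/
def MatsubaraBridgeShifted : Prop :=
  ∀ (L : ℕ) [NeZero L] (β U μ h Λ₀ : ℝ) (K' : TrigPolyC4v), 3 ≤ L → 0 < β → 0 < Λ₀ →
    (∀ k : Literature.Probability.LatticeModels.TorusSite 2 L, Λ₀ ≤ |nambuXiCT L μ K' k|) →
    Tendsto (fun M : ℕ => scaleMeanFieldDensityCT L M β U μ h K' Λ₀) atTop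
      (nhds ((Matrix.gibbsState β (dWaveSourceTorus L U (μ + U / 2) h) (pairField dWaveFormFactor L)).re / (L : ℝ) ^ 2))

/-- **Repair (a) re-glues by pure logic**: `[2]′ → [3]′ → R′ → FixedPointDWaveOrder`, witness `(U, δ, μ + U/2)`. -/
theorem fixedPoint_of_repairedChain :
    CapRgSymmetricCertificatePinned' → SeededBrokenRegimeBoseFermiPinned' → AposterioriOrderCriterionR' →
      FixedPointDWaveOrder := by
  intro h2 h3 hR
  obtain ⟨kStar, etaStar, hk, he, hRall⟩ := hR
  obtain ⟨Θ, h3all⟩ := h3 kStar etaStar hk he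
  obtain ⟨U, hU, δ, hδ, μ, hdens, hcert⟩ := h2
  obtain ⟨K, Λ, L₀, hc⟩ := hcert Θ
  obtain ⟨h₀, hh₀, D, hmeets, _hnp, hm₀, hencl⟩ := h3all U hU δ hδ μ hdens K Λ L₀ hc
  have hle := hRall U μ h₀ D hh₀ hencl hmeets
  have hm₀' : (0 : ℝ) < ((D.meanFieldDensity.fst : ℚ) : ℝ) := by exact_mod_cast hm₀
  refine ⟨U, hU, δ, hδ, μ + U / 2, hdens, ?_⟩
  rw [hasDWaveOrder_iff]
  linarith

/-- For contrast: R as typed composes with the SAME [2], [3] only because all three carry the mismatch coherently in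
their texts; the tree already proves that below the band edge R's conclusion side is the sourced vacuum while its
hypothesis side is the fully integrated Grassmann functional at `μ` (Theorems/AposterioriOrderCriterionR/Negative/BelowBand.lean). -/
example : CapRgSymmetricCertificatePinned → SeededBrokenRegimeBoseFermiPinned → AposterioriOrderCriterionR →
    FixedPointDWaveOrder := FixedPointOfCertifiedChain_holds

end X1Probe
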